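import Literature.IUT.LogThetaLattice.HolomorphicHullDetMDegree
import Literature.IUT.LogVolume.AdelicPacketModel
import HarnessLib

/-!
# [IUTchIII] Remark 3.9.5 (vii) (Ob3-3)/(Ob4) and (ix) (⊼lc_1) at the GENUINE carriers `K_j = F_{v_j}`:
# the residue dictionary `q_{K_j} = N(v_j)` is a THEOREM at the completions of a number field, so the
# degree / log-volume identities of `HolomorphicHullDetMDegree.lean` hold there WITHOUT hypothesis
# (abc-iut cell, layer L6, zone [IUTchIII] §3; typer-of-record lineage abc-iut-L6-t4; PROOF-ONLY — no
# definition, no instance, no notation; nothing of another seat is edited)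

S. Mochizuki, *Inter-universal Teichmüller theory III*, kurims manuscript (May 2020), §3, Remark 3.9.5 (vii)
pp. 131–134 and (ix) pp. 141–142 [claim: Mochizuki2012, status: disputed], read on the page (cell render
`paper:url-4b091feeb646` p0131–p0134, p0141–p0142): (Ob3) p. 131 l. 44 ff. "each [hull] … may be regarded as
defining the local portion [at `v_ℚ`] of a global arithmetic vector bundle … by allowing `v_ℚ ∈ 𝕍_ℚ`, `v ∈ 𝕍` to
vary] global Frobenioids"; (Ob3-3) p. 132 l. 40 – p. 133 l. 8 "the arithmetic degree of such an arithmetic line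
bundle may be interpreted, by working with suitable normalization factors, as the log-volume of the original
arithmetic vector bundle"; (Ob4) p. 133 l. 9–21; (⊼lc_1) p. 141 l. 34–44.  In print the direct summands of
`𝓘^ℚ(^α𝓕_{v_ℚ}) ≅ ⊕_j K_j` ARE completions `K_v` of the number field `K` at places `v | v_ℚ` ([IUTchIII]
Prop. 3.1 (i) p. 92; Rmk. 3.1.1 (ii) p. 94 "`K_v`").

WHAT THE TREE HAD (consumed BY NAME, nothing re-declared).  abc-iut-L6-t4 g6/g7's `HolomorphicHullDetM(Degree).lean`
(p445358 / p448148): over an ABSTRACT family `K : J → Type` of ultrametric local fields with chosen norm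
uniformizers `ϖ_j` and an attachment `pl : J → 𝕍(F)^non` of the summands to finite places of a number field `F`,
`HullDetM.exponents / detExponents / logDegree / globalExponents / frakObj` and the degree identities
`frakDeg_realifyObj_frakObj` (`deg det^{⊗M}(λ·𝒪_L) = −Σ_j m_j e_j log N(pl j)`),
`frakDeg_realifyObj_frakObj_eq_logDegree`, `…_eq_mul_boxLogVolume` and `frakDeg_le_mul_boxLogVolume_of_upperObj_linear`
— the last three UNDER the residue dictionary `hq : ∀ j, q_{K_j} = N(pl j)` as a HYPOTHESIS (the summands being
abstract).  The number-theory side: `Literature.NumberTheory.GaloisRepresentations.Ultrametric.AdicCompletion.*`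
(`card_residueField_eq_absNorm : #(𝒪_v/𝔪_v) = N(v)`, `isUniformizer_iff_valuation_eq_exp`, `norm_units_eq_absNorm_zpow`,
`exists_isUniformizer`) and campaign-S's completion model `Literature.IUT.LogVolume.CompletionModel.*` (`ordv`,
`norm_units`, `mulLogVolume_eq`), both over Mathlib's `v.adicCompletion F`.

RESULTS (sorry-free; axioms standard).  At `K_j := F_{pl j} = (pl j).adicCompletion F` (Mathlib), with the
cell's standing local instances (`AdicCompletion.nontriviallyNormedField`, the tree's `properSpace_adicCompletion`,
the Borel σ-algebra `CompletionModel.measurableSpace`):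
* §0 (any nontrivially normed field) **norm uniformizers all have the same norm** (`IsUniformizer.norm_eq`,
  `IsUniformizer.ordFun_eq`), so the lineage's `exponents / detExponents / logDegree / globalExponents / frakObj`
  do NOT depend on the chosen uniformizer family (`…_eq_of_isUniformizer`) — the parenthetical "(any choice gives
  the same vector)" of `HullDetM.exponents` is now a theorem;
* §1 **the residue dictionary is a theorem**: `residueCard_adicCompletion : q_{F_v} = N(v)` (hence
  `log q_{F_v} = log N(v)`, `log_residueCard_adicCompletion`); norm uniformizers of `F_v` have `‖ϖ‖ = N(v)⁻¹`
  (`norm_eq_inv_absNorm_of_isUniformizer`) and uniformizer FAMILIES exist (`exists_isUniformizer_family`);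
* §2 **uniformizer-free closed forms**: the exponent vector of `λ·𝒪_L` is Mathlib's additive valuation,
  `e_j(λ) = ord_{v_j}(λ_j)` (`exponents_adicCompletion`, read off `Valued.v`);
  `deg^{log}(det^{⊗M}(λ·𝒪_L)) = −Σ_j m_j ord_{v_j}(λ_j) log N(v_j)`
  (`logDegree_adicCompletion`) and `μ^{log}_w(λ·𝒪_L) = −Σ_j w_j ord_{v_j}(λ_j) log N(v_j)` (`boxLogVolume_hullSet_adicCompletion`);
* §3 **(Ob3-3)/(Ob4)/(⊼lc_1) hypothesis-free at the completions**:
  `frakDeg_realifyObj_frakObj_eq_logDegree_adicCompletion` (GLOBAL degree = LOCAL log-degree),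
  **`frakDeg_realifyObj_frakObj_eq_mul_boxLogVolume_adicCompletion`** (`deg det^{⊗M}(λ·𝒪_L) = M·μ^{log}_w(λ·𝒪_L)` for
  weights `m_j = M·w_j`), the closed form `frakDeg_realifyObj_frakObj_adicCompletion`
  (`= −Σ_j m_j ord_{v_j}(λ_j) log N(v_j)`), and **`frakDeg_le_mul_boxLogVolume_of_upperObj_linear_adicCompletion`**
  (a `⊼`-object `P` under `det^{⊗M}(λ·𝒪_L)` with LINEAR structure poly-morphism has `deg P ≤ M·μ^{log}_w(λ·𝒪_L)`).

HONEST SCOPE.  This removes the one stated hypothesis (`hq`) of the lineage's (Ob3-3)/(Ob4)/(⊼lc_1) degree identities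
in print's own case `K_j = F_{v_j}`; it is a junction at the genuine carrier, not the disputed comparison of
[IUTchIII] Cor. 3.12 Step (xi) (whether the `q`-pilot object admits a linear morphism to `det^{⊗M}(φ(P_B))`), on
which nothing here bears; no side is taken; typed ≠ proved.  Proof-only: no definition, no instance, no notation.
-/

noncomputable section

open MeasureTheory Set Metric CategoryTheory
open scoped ENNReal NNReal
open Literature.NumberTheory.GaloisRepresentations.Ultrametric

namespace Literature.IUT.LogThetaLattice

namespace HullDetM

open NumberField IsDedekindDomain Literature.IUT.LogVolume GlobalFrobenioidModels

attribute [local instance] AdicCompletion.nontriviallyNormedField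
attribute [local instance] Literature.NumberTheory.Automorphic.properSpace_adicCompletion
attribute [local instance] CompletionModel.measurableSpace

/-- `F_v` with its Borel σ-algebra (`CompletionModel.measurableSpace`) is a Borel space (local instance for this
file; plumbing, as in campaign-S's `AdelicPacketModel`). [folklore] -/
private theorem borelSpace_adicCompletion (F : Type) [Field F] [NumberField F] (v : HeightOneSpectrum (𝓞 F)) :
    BorelSpace (v.adicCompletion F) := ⟨rfl⟩

attribute [local instance] borelSpace_adicCompletion

/-! ### §0 Norm uniformizers: the choice is immaterial (any nontrivially normed field) -/

section General

variable {L : Type*} [NontriviallyNormedField L]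

/-- **Two norm uniformizers of the same field have the same norm** (`ϖ'𝒪 ⊆ ϖ𝒪` and conversely: each generates
the maximal ideal `{‖x‖ < 1}`; tree `IsUniformizer.norm_le_of_norm_lt_one`).  Dot-notation extension of the tree's
`IsUniformizer` (directory `NumberTheory/GaloisRepresentations`), declared here with its absolute name.
[cite: NeukirchANT1999, Ch. II Prop. (3.8)] -/
theorem _root_.Literature.NumberTheory.GaloisRepresentations.Ultrametric.IsUniformizer.norm_eq {ϖ ϖ' : Lˣ}
    (hϖ : IsUniformizer ϖ) (hϖ' : IsUniformizer ϖ') : ‖(ϖ : L)‖ = ‖(ϖ' : L)‖ :=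
  le_antisymm (hϖ'.norm_le_of_norm_lt_one _ hϖ.norm_lt_one) (hϖ.norm_le_of_norm_lt_one _ hϖ'.norm_lt_one)

/-- Hence **the order function `ord_ϖ` does not depend on the uniformizer**: `ord_ϖ(y) = ord_{ϖ'}(y)`.
[cite: NeukirchANT1999, Ch. II Prop. (3.8)] -/
theorem _root_.Literature.NumberTheory.GaloisRepresentations.Ultrametric.IsUniformizer.ordFun_eq {ϖ ϖ' : Lˣ}
    (hϖ : IsUniformizer ϖ) (hϖ' : IsUniformizer ϖ') (y : Lˣ) : hϖ.ordFun y = hϖ'.ordFun y := by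
  rw [hϖ.ordFun_eq_iff, hϖ.norm_eq hϖ']
  exact hϖ'.norm_eq_zpow_ordFun y

variable {J : Type*} (K : J → Type*) [∀ j, NontriviallyNormedField (K j)]
  {ϖ ϖ' : ∀ j, (K j)ˣ} (hϖ : ∀ j, IsUniformizer (ϖ j)) (hϖ' : ∀ j, IsUniformizer (ϖ' j))

/-- The exponent vector `e_j(λ·𝒪_L)` of [IUTchIII] Rmk. 3.9.5 (vii) (Ob3) does not depend on the chosen uniformizer
family ((Ob1) p. 131: generators / trivialisations are determined up to units; the lineage's `exponents` is stated
"relative to chosen uniformizers `ϖ_j` (any choice gives the same vector)" — PROVED here).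
[claim: Mochizuki2012, status: disputed] -/
theorem exponents_eq_of_isUniformizer (c : Π j, (K j)ˣ) : exponents K hϖ c = exponents K hϖ' c := by
  funext j
  exact (hϖ j).ordFun_eq (hϖ' j) (c j)

/-- … nor does `det^{⊗M}` at the divisor level. [claim: Mochizuki2012, status: disputed] -/
theorem detExponents_eq_of_isUniformizer (m : J → ℤ) (c : Π j, (K j)ˣ) :
    detExponents K hϖ m c = detExponents K hϖ' m c := by
  funext j
  rw [detExponents, detExponents, exponents_eq_of_isUniformizer K hϖ hϖ']

/-- … nor the log-degree `deg^{log}(det^{⊗M}(λ·𝒪_L))`. [claim: Mochizuki2012, status: disputed] -/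
theorem logDegree_eq_of_isUniformizer [Fintype J] [∀ j, IsUltrametricDist (K j)] (m : J → ℤ) (c : Π j, (K j)ˣ) :
    logDegree K hϖ m c = logDegree K hϖ' m c := by
  unfold logDegree
  rw [exponents_eq_of_isUniformizer K hϖ hϖ']

variable [Fintype J] (F : Type) [Field F] [NumberField F] (pl : J → HeightOneSpectrum (𝓞 F))

omit [NumberField F] in
/-- … nor the global exponent family `Σ_j m_j e_j·[pl j]`. [claim: Mochizuki2012, status: disputed] -/
theorem globalExponents_eq_of_isUniformizer (m : J → ℤ) (c : Π j, (K j)ˣ) :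
    globalExponents K hϖ F pl m c = globalExponents K hϖ' F pl m c := by
  unfold globalExponents
  rw [detExponents_eq_of_isUniformizer K hϖ hϖ']

/-- … nor **the object `det^{⊗M}(λ·𝒪_L)` of the model global Frobenioid `(†𝓕⊛_𝔪𝔬𝔡)`**: it is attached to the
HULL, as (Ob3) requires. [claim: Mochizuki2012, status: disputed] -/
theorem frakObj_eq_of_isUniformizer (m : J → ℤ) (c : Π j, (K j)ˣ) :
    frakObj K hϖ F pl m c = frakObj K hϖ' F pl m c := by
  unfold frakObj
  rw [globalExponents_eq_of_isUniformizer K hϖ hϖ']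

end General

section Plumbing

variable (F : Type) [Field F] [NumberField F] (v : HeightOneSpectrum (𝓞 F))

/-! ### §1 The residue dictionary `q_{F_v} = N(v)` is a theorem at the completions -/

/-- **`q_{F_v} = N(v)`**: the residue cardinality of the completion `F_v` in the sense of campaign-S's
`residueCard` ([AbsTopIII] Prop. 5.7 (i)(a): `#(𝒪_v/𝔪_v)`, for the norm valuation ring) is the absolute norm of `v`
(tree `AdicCompletion.card_residueField_eq_absNorm`).  This is the residue dictionary `hq` of
`HolomorphicHullDetMDegree.lean`, as a THEOREM in print's case `K_j = F_{v_j}` (Neukirch: `𝒪/𝔭 ≅ 𝒪̂/𝔭̂` and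
`𝔑(𝔭) = (𝒪 : 𝔭)`). [cite: NeukirchANT1999, Ch. II Prop. (4.3)] -/
theorem residueCard_adicCompletion : residueCard (v.adicCompletion F) = Ideal.absNorm v.asIdeal :=
  AdicCompletion.card_residueField_eq_absNorm F v

/-- `log q_{F_v} = log N(v)` (campaign-S `logNorm`). [cite: NeukirchANT1999, Ch. II Prop. (4.3)] -/
theorem log_residueCard_adicCompletion : Real.log (residueCard (v.adicCompletion F)) = logNorm F v := by
  rw [residueCard_adicCompletion, logNorm]

/-- A norm uniformizer `ϖ` of `F_v` has `‖ϖ‖ = N(v)⁻¹` for the normalized absolute value `|a|_𝔭 = 𝔑(𝔭)^{-v_𝔭(a)}`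
(Mathlib `FinitePlace.norm_def`; tree: `IsUniformizer ϖ ↔ Valued.v ϖ = exp(-1)`, and then `‖ϖ‖ = N(v)⁻¹`).
[cite: NeukirchANT1999, Ch. III §1 (normalized valuation `|a|_𝔭 = 𝔑(𝔭)^{-v_𝔭(a)}`, before Prop. (1.3))] -/
theorem norm_eq_inv_absNorm_of_isUniformizer (ϖ : (v.adicCompletion F)ˣ) (hϖ : IsUniformizer ϖ) :
    ‖(ϖ : v.adicCompletion F)‖ = (((Ideal.absNorm v.asIdeal : ℕ) : ℝ))⁻¹ := by
  have hexp := (AdicCompletion.isUniformizer_iff_valuation_eq_exp F v ϖ).mp hϖ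
  exact (AdicCompletion.isUniformizer_of_valuation_eq F v ϖ (by rw [hexp]; rfl)).2

/-- A norm uniformizer `ϖ` of `F_v` has `ord_v(ϖ) = 1` (campaign-S `CompletionModel.ordv`, read off `Valued.v`;
prime elements have valuation one). [cite: NeukirchANT1999, Ch. II Prop. (3.8)] -/
theorem ordv_eq_one_of_isUniformizer (ϖ : (v.adicCompletion F)ˣ) (hϖ : IsUniformizer ϖ) :
    CompletionModel.ordv F v ϖ = 1 := by
  have hN : (1 : ℝ) < ((Ideal.absNorm v.asIdeal : ℕ) : ℝ) := by
    exact_mod_cast NumberField.HeightOneSpectrum.one_lt_absNorm v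
  have h := norm_eq_inv_absNorm_of_isUniformizer F v ϖ hϖ
  rw [CompletionModel.norm_units, ← zpow_neg_one] at h
  have := zpow_right_injective₀ (zero_lt_one.trans hN) hN.ne' h
  omega

end Plumbing

section Family

variable (F : Type) [Field F] [NumberField F] {J : Type*} (pl : J → HeightOneSpectrum (𝓞 F))

/-- **Uniformizer families exist**: for any attachment `pl` of summands to finite places there are norm
uniformizers `ϖ_j ∈ F_{pl j}` (tree `AdicCompletion.exists_isUniformizer`, one choice per `j`; prime elements of the
discrete valuation rings `𝒪_{v_j}`). [cite: NeukirchANT1999, Ch. II Prop. (3.8)] -/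
theorem exists_isUniformizer_family :
    ∃ ϖ : ∀ j, ((pl j).adicCompletion F)ˣ, ∀ j, IsUniformizer (ϖ j) :=
  ⟨fun j => (AdicCompletion.exists_isUniformizer F (pl j)).choose,
    fun j => (AdicCompletion.exists_isUniformizer F (pl j)).choose_spec⟩

/-- The residue dictionary for a whole family of completions: `∀ j, q_{F_{pl j}} = N(pl j)` — the hypothesis `hq` of
`frakDeg_realifyObj_frakObj_eq_logDegree` / `…_eq_mul_boxLogVolume` / `frakDeg_le_mul_boxLogVolume_of_upperObj_linear`,
DISCHARGED. [cite: NeukirchANT1999, Ch. II Prop. (4.3)] -/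
theorem residueCard_adicCompletion_family :
    ∀ j, residueCard ((pl j).adicCompletion F) = Ideal.absNorm (pl j).asIdeal :=
  fun j => residueCard_adicCompletion F (pl j)

/-! ### §2 Uniformizer-free closed forms at the completions -/

variable {ϖ : ∀ j, ((pl j).adicCompletion F)ˣ} (hϖ : ∀ j, IsUniformizer (ϖ j))

/-- **`e_j(λ·𝒪_L) = ord_{v_j}(λ_j)`**: at the completions the exponent vector of the arithmetic vector bundle
`λ·𝒪_L = ⊕_j λ_j 𝒪_{F_{v_j}}` ([IUTchIII] Rmk. 3.9.5 (vii) (Ob2)/(Ob3) p. 131) is Mathlib's additive valuation of the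
generator (campaign-S `CompletionModel.ordv`), whatever norm uniformizers were chosen.
[claim: Mochizuki2012, status: disputed] -/
theorem exponents_adicCompletion (c : Π j, ((pl j).adicCompletion F)ˣ) (j : J) :
    exponents (fun j => (pl j).adicCompletion F) hϖ c j = CompletionModel.ordv F (pl j) (c j) := by
  show (hϖ j).ordFun (c j) = _
  rw [(hϖ j).ordFun_eq_iff, norm_eq_inv_absNorm_of_isUniformizer F (pl j) (ϖ j) (hϖ j),
    CompletionModel.norm_units, inv_zpow']

/-- `det^{⊗M}` at the divisor level, closed form: `(det^{⊗M}(λ·𝒪_L))_j = m_j · ord_{v_j}(λ_j)` ([IUTchIII] Rmk. 3.9.5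
(vii) (Ob3-1-1)/(Ob3-2) pp. 131–132). [claim: Mochizuki2012, status: disputed] -/
theorem detExponents_adicCompletion (m : J → ℤ) (c : Π j, ((pl j).adicCompletion F)ˣ) (j : J) :
    detExponents (fun j => (pl j).adicCompletion F) hϖ m c j = m j * CompletionModel.ordv F (pl j) (c j) := by
  rw [detExponents, exponents_adicCompletion]

variable [Fintype J]

/-- **`deg^{log}(det^{⊗M}(λ·𝒪_L)) = −Σ_j m_j · ord_{v_j}(λ_j) · log N(v_j)`** at the completions ((Ob3-3) p. 132–133,
closed form; residue dictionary and uniformizers eliminated). [claim: Mochizuki2012, status: disputed] -/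
theorem logDegree_adicCompletion (m : J → ℤ) (c : Π j, ((pl j).adicCompletion F)ˣ) :
    logDegree (fun j => (pl j).adicCompletion F) hϖ m c =
      -∑ j, (m j : ℝ) * (CompletionModel.ordv F (pl j) (c j) : ℝ) * logNorm F (pl j) := by
  unfold logDegree
  congr 1
  refine Finset.sum_congr rfl fun j _ => ?_
  rw [exponents_adicCompletion, log_residueCard_adicCompletion]

/-- **`μ^{log}_w(λ·𝒪_L) = −Σ_j w_j · ord_{v_j}(λ_j) · log N(v_j)`**: campaign-S's Rmk. 3.1.1 (iii) weighted hull
log-volume at the genuine completions, by `μ^log_{F_v}(y·𝒪_v) = −ord_v(y)·log N(v)` (campaign-S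
`CompletionModel.mulLogVolume_eq`, Haar measure on `F_v`). [claim: Mochizuki2012, status: disputed] -/
theorem boxLogVolume_hullSet_adicCompletion (w : J → ℝ) (c : Π j, ((pl j).adicCompletion F)ˣ) :
    boxLogVolume (fun j => (pl j).adicCompletion F) w
        (hullSet (fun j => (pl j).adicCompletion F) (fun j => (c j : (pl j).adicCompletion F))) =
      -∑ j, w j * (CompletionModel.ordv F (pl j) (c j) : ℝ) * logNorm F (pl j) := by
  rw [boxLogVolume_hullSet, ← Finset.sum_neg_distrib]
  refine Finset.sum_congr rfl fun j _ => ?_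
  rw [CompletionModel.mulLogVolume_eq]
  ring

/-- The global exponent family of `det^{⊗M}(λ·𝒪_L)`, closed form: `Σ_j m_j ord_{v_j}(λ_j)·[pl j]` ((Ob3) p. 131
"global Frobenioids"). [claim: Mochizuki2012, status: disputed] -/
theorem globalExponents_adicCompletion (m : J → ℤ) (c : Π j, ((pl j).adicCompletion F)ˣ) :
    globalExponents (fun j => (pl j).adicCompletion F) hϖ F pl m c =
      ∑ j, Finsupp.single (pl j) (m j * CompletionModel.ordv F (pl j) (c j)) := by
  unfold globalExponents
  exact Finset.sum_congr rfl fun j _ => by rw [detExponents_adicCompletion]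

/-! ### §3 (Ob3-3)/(Ob4)/(⊼lc_1) hypothesis-free at the completions -/

/-- **(Ob3-3): GLOBAL degree = LOCAL log-degree, at the completions, hypothesis-free** ([IUTchIII] Rmk. 3.9.5 (vii)
p. 132–133): `deg det^{⊗M}(λ·𝒪_L) = deg^{log}(det^{⊗M}(λ·𝒪_L))` — the lineage's `frakDeg_realifyObj_frakObj_eq_logDegree`
with its residue dictionary `hq` supplied by `residueCard_adicCompletion`. [claim: Mochizuki2012, status: disputed] -/
theorem frakDeg_realifyObj_frakObj_eq_logDegree_adicCompletion (m : J → ℤ)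
    (c : Π j, ((pl j).adicCompletion F)ˣ) :
    frakDeg (Prop37.realifyObj F (frakObj (fun j => (pl j).adicCompletion F) hϖ F pl m c)) =
      logDegree (fun j => (pl j).adicCompletion F) hϖ m c :=
  frakDeg_realifyObj_frakObj_eq_logDegree _ hϖ F pl (residueCard_adicCompletion_family F pl) m c

/-- **(Ob3-3) closed form at the completions**: `deg det^{⊗M}(λ·𝒪_L) = −Σ_j m_j · ord_{v_j}(λ_j) · log N(v_j)` —
no dictionary, no uniformizer on the right ([IUTchIII] Rmk. 3.9.5 (vii) p. 132–133; [FrdI] Thm. 6.4 (i) degree on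
the realification). [claim: Mochizuki2012, status: disputed] -/
theorem frakDeg_realifyObj_frakObj_adicCompletion (m : J → ℤ) (c : Π j, ((pl j).adicCompletion F)ˣ) :
    frakDeg (Prop37.realifyObj F (frakObj (fun j => (pl j).adicCompletion F) hϖ F pl m c)) =
      -∑ j, (m j : ℝ) * (CompletionModel.ordv F (pl j) (c j) : ℝ) * logNorm F (pl j) := by
  rw [frakDeg_realifyObj_frakObj_eq_logDegree_adicCompletion, logDegree_adicCompletion]

/-- **(Ob3-3) in full at the completions, hypothesis-free: `deg det^{⊗M}(λ·𝒪_L) = M · μ^{log}_w(λ·𝒪_L)`** for integer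
weights `m_j = M·w_j` ([IUTchIII] Rmk. 3.9.5 (vii) p. 132 l. 40 – p. 133 l. 8: "the arithmetic degree of such an
arithmetic line bundle may be interpreted, by working with suitable normalization factors, as the log-volume of
the original arithmetic vector bundle"; `μ^{log}_w` = campaign-S's Rmk. 3.1.1 (iii) weighted log-volume of Haar
measure on the genuine `⊕_j F_{v_j}`) — the lineage's `frakDeg_realifyObj_frakObj_eq_mul_boxLogVolume` with `hq`
DISCHARGED. [claim: Mochizuki2012, status: disputed] -/
theorem frakDeg_realifyObj_frakObj_eq_mul_boxLogVolume_adicCompletion (m : J → ℤ) (w : J → ℝ) (M : ℝ)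
    (hm : ∀ j, (m j : ℝ) = M * w j) (c : Π j, ((pl j).adicCompletion F)ˣ) :
    frakDeg (Prop37.realifyObj F (frakObj (fun j => (pl j).adicCompletion F) hϖ F pl m c)) =
      M * boxLogVolume (fun j => (pl j).adicCompletion F) w
        (hullSet (fun j => (pl j).adicCompletion F) (fun j => (c j : (pl j).adicCompletion F))) :=
  frakDeg_realifyObj_frakObj_eq_mul_boxLogVolume _ hϖ F pl (residueCard_adicCompletion_family F pl) m w M hm c

/-- The global log-volume of [IUTchIII] Prop. 3.9 (iii) of the region of `det^{⊗M}(λ·𝒪_L)` is `M · μ^{log}_w(λ·𝒪_L)`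
at the completions (lineage `globalLogVolume_frakRegion_frakObj` + the above). [claim: Mochizuki2012, status: disputed] -/
theorem globalLogVolume_frakRegion_frakObj_eq_mul_boxLogVolume_adicCompletion (m : J → ℤ) (w : J → ℝ) (M : ℝ)
    (hm : ∀ j, (m j : ℝ) = M * w j) (c : Π j, ((pl j).adicCompletion F)ˣ) :
    globalLogVolume (divisorLogVolume F)
        (frakRegion (Prop37.realifyObj F (frakObj (fun j => (pl j).adicCompletion F) hϖ F pl m c))) =
      M * boxLogVolume (fun j => (pl j).adicCompletion F) w
        (hullSet (fun j => (pl j).adicCompletion F) (fun j => (c j : (pl j).adicCompletion F))) := by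
  rw [globalLogVolume_frakRegion, frakDeg_realifyObj_frakObj_eq_mul_boxLogVolume_adicCompletion F pl hϖ m w M hm]

/-- **(Ob4) + (⊼lc_1) in log-volume currency at the completions, hypothesis-free**: a `⊼`-object `P` of
`(†𝓕⊛_𝔪𝔬𝔡)` under `det^{⊗M}(λ·𝒪_L)` whose structure poly-morphism is LINEAR has `deg P ≤ M · μ^{log}_w(λ·𝒪_L)` for
weights `m_j = M·w_j` ([IUTchIII] Rmk. 3.9.5 (vii) (Ob4) p. 133 l. 9–21, (ix) (⊼lc_1) p. 141 l. 34–44) — the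
lineage's `frakDeg_le_mul_boxLogVolume_of_upperObj_linear` with `hq` DISCHARGED.  Whether the object arising from
the `q`-pilot object carries such a structure is [IUTchIII] Cor. 3.12 Step (xi) and is NOT addressed.
[claim: Mochizuki2012, status: disputed] -/
theorem frakDeg_le_mul_boxLogVolume_of_upperObj_linear_adicCompletion (m : J → ℤ) (w : J → ℝ) (M : ℝ)
    (hm : ∀ j, (m j : ℝ) = M * w j) (c : Π j, ((pl j).adicCompletion F)ˣ)
    (A : UpperCat.Obj (FrakCat.of (frakObj (fun j => (pl j).adicCompletion F) hϖ F pl m c) : Prop37.Ffrak F))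
    (hA : FrakCat.deg A.hom = 1) :
    frakDeg (Prop37.realifyObj F A.obj.obj) ≤
      M * boxLogVolume (fun j => (pl j).adicCompletion F) w
        (hullSet (fun j => (pl j).adicCompletion F) (fun j => (c j : (pl j).adicCompletion F))) :=
  frakDeg_le_mul_boxLogVolume_of_upperObj_linear _ hϖ F pl (residueCard_adicCompletion_family F pl) m w M hm c A hA

/-- The same in the uniformizer-free closed form: `deg P ≤ −Σ_j m_j · ord_{v_j}(λ_j) · log N(v_j)` for every
`⊼`-object `P` under `det^{⊗M}(λ·𝒪_L)` with linear structure poly-morphism. [claim: Mochizuki2012, status: disputed] -/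
theorem frakDeg_le_of_upperObj_linear_adicCompletion (m : J → ℤ) (c : Π j, ((pl j).adicCompletion F)ˣ)
    (A : UpperCat.Obj (FrakCat.of (frakObj (fun j => (pl j).adicCompletion F) hϖ F pl m c) : Prop37.Ffrak F))
    (hA : FrakCat.deg A.hom = 1) :
    frakDeg (Prop37.realifyObj F A.obj.obj) ≤
      -∑ j, (m j : ℝ) * (CompletionModel.ordv F (pl j) (c j) : ℝ) * logNorm F (pl j) := by
  rw [← frakDeg_realifyObj_frakObj_adicCompletion F pl hϖ m c]
  have h := UpperCat.frakDeg_le_of_linear F _ A hA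
  rwa [FrakCat.obj_of] at h

/-- … and for a structure poly-morphism of any Frobenius degree `n`: `n · deg P ≤ −Σ_j m_j ord_{v_j}(λ_j) log N(v_j)`.
[claim: Mochizuki2012, status: disputed] -/
theorem frakDeg_mul_le_of_upperObj_adicCompletion (m : J → ℤ) (c : Π j, ((pl j).adicCompletion F)ˣ)
    (A : UpperCat.Obj (FrakCat.of (frakObj (fun j => (pl j).adicCompletion F) hϖ F pl m c) : Prop37.Ffrak F)) :
    ((FrakCat.deg A.hom : ℕ) : ℝ) * frakDeg (Prop37.realifyObj F A.obj.obj) ≤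
      -∑ j, (m j : ℝ) * (CompletionModel.ordv F (pl j) (c j) : ℝ) * logNorm F (pl j) := by
  rw [← frakDeg_realifyObj_frakObj_adicCompletion F pl hϖ m c]
  have h := UpperCat.frakDeg_mul_le F _ A
  rwa [FrakCat.obj_of] at h

end Family

end HullDetM

end Literature.IUT.LogThetaLattice
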